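import Mathlib
import HarnessLib

/-!
# Jarzynski / annealed importance sampling on a general state space (Feynman–Kac form)

HONEST FRAMING: exact (Metropolis-corrected) sampling algorithms for lattice gauge theory;
figures of merit are autocorrelation/cost numbers at stated couplings and volumes; no
continuum-physics claim.

Venture `LatticeQCDFlow` (cell pub-lqcd), topic `Exactness`, FANOUT row 30 (lean-1); the item
"general-state-space E4 over Markov kernels" of HOME/VENTURE-STATEMENT.md (row
`Exactness/Jarzynski.lean`: "general-state E4 over `Kernel.comp` later").  The finite-state,
path-sum version is `Exactness/JarzynskiFinite.lean` (`jarzynski_observable`); here the state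
space is an arbitrary measurable space and the kernels are Mathlib `ProbabilityTheory.Kernel`s,
at the price of working with the WEIGHTED MARGINALS (Feynman–Kac semigroup form) instead of an
explicit path measure.  NEW WORK of the cell; nothing cited as a fact (Jarzynski 1997, Neal 2001,
Crooks 2000 named only).

## Content (reference measure `vol`, actions `S k : Ω → ℝ`, Boltzmann measures `e^{−S k} · vol`)

* `boltzmann vol S = e^{−S} · vol` (un-normalised);
* `neStep S S' κ ν = κ ∘ (e^{−(S' − S)} · ν)` — one non-equilibrium step acting on un-normalised
  measures: reweight by the work factor `e^{−ΔW}`, `ΔW = S'(x) − S(x)` (action switched at fixed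
  configuration), then move with the kernel `κ`.  Iterating from `ν₀ = e^{−S 0} vol` gives the
  weighted marginals `ν_k(B) = E[e^{−W_k} ; X_k ∈ B]` of the NE-MCMC chain (Markov property);
* `neStep_boltzmann` — if `κ` leaves `e^{−S'} vol` invariant (`Kernel.Invariant`), one step maps
  `e^{−S} vol` to `e^{−S'} vol` EXACTLY (telescoping `e^{−S} e^{−(S'−S)} = e^{−S'}` + invariance);
* `neMarginal_eq_boltzmann` — by induction the `k`-th weighted marginal IS `e^{−S k} vol`:
  `E[e^{−W_k} f(X_k)] = ∫ f e^{−S k} dvol` for every protocol and every family of invariant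
  kernels (heat bath, HMC, the flow kernels of `IMHKernel.lean` / `InvolutiveJacobian.lean`) —
  Jarzynski (`f = 1`: `E[e^{−W}] = Z_k/Z_0` after normalising the start) and the reweighting
  identity on general spaces.  Only invariance is used — no reversibility, no ergodicity.
-/

namespace Summit.Ventures.LatticeQCDFlow.Exactness

open MeasureTheory ProbabilityTheory
open scoped ENNReal

variable {Ω : Type*} [MeasurableSpace Ω]

/-- The un-normalised Boltzmann measure `e^{−S} · vol`. -/
noncomputable def boltzmann (vol : Measure Ω) (S : Ω → ℝ) : Measure Ω :=
  vol.withDensity fun x => ENNReal.ofReal (Real.exp (-S x))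

/-- One NON-EQUILIBRIUM step on un-normalised measures: reweight by the work factor
`e^{−(S' x − S x)}` (switch the action at fixed configuration), then move with `κ`. -/
noncomputable def neStep (S S' : Ω → ℝ) (κ : Kernel Ω Ω) (ν : Measure Ω) : Measure Ω :=
  (ν.withDensity fun x => ENNReal.ofReal (Real.exp (-(S' x - S x)))).bind κ

/-- Telescoping of the weights: `e^{−(S'−S)} · (e^{−S} · vol) = e^{−S'} · vol`. -/
theorem boltzmann_withDensity_work (vol : Measure Ω) {S S' : Ω → ℝ} (hS : Measurable S)
    (hS' : Measurable S') :
    (boltzmann vol S).withDensity (fun x => ENNReal.ofReal (Real.exp (-(S' x - S x)))) =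
      boltzmann vol S' := by
  have h1 : Measurable fun x => ENNReal.ofReal (Real.exp (-S x)) :=
    (Real.measurable_exp.comp hS.neg).ennreal_ofReal
  have h2 : Measurable fun x => ENNReal.ofReal (Real.exp (-(S' x - S x))) :=
    (Real.measurable_exp.comp (hS'.sub hS).neg).ennreal_ofReal
  unfold boltzmann
  rw [← withDensity_mul _ h1 h2]
  congr 1
  funext x
  simp only [Pi.mul_apply]
  rw [← ENNReal.ofReal_mul (Real.exp_pos _).le, ← Real.exp_add]
  congr 2
  ring

/-- **One exact NE step.**  If `κ` leaves `e^{−S'} vol` invariant, the non-equilibrium step maps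
`e^{−S} vol` to `e^{−S'} vol`. -/
theorem neStep_boltzmann {vol : Measure Ω} {S S' : Ω → ℝ} (hS : Measurable S)
    (hS' : Measurable S') {κ : Kernel Ω Ω} (hκ : Kernel.Invariant κ (boltzmann vol S')) :
    neStep S S' κ (boltzmann vol S) = boltzmann vol S' := by
  unfold neStep
  rw [boltzmann_withDensity_work vol hS hS']
  exact hκ

/-- The weighted marginals of an NE-MCMC protocol `(S k, κ k)_k`: start at `e^{−S 0} vol`, then
alternate "switch `S k → S (k+1)` and reweight by `e^{−ΔW}`" with "move by `κ k`".  By the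
Markov property `neMarginal vol S κ k (B) = E[e^{−W_k} ; X_k ∈ B]` (start un-normalised). -/
noncomputable def neMarginal (vol : Measure Ω) (S : ℕ → Ω → ℝ) (κ : ℕ → Kernel Ω Ω) :
    ℕ → Measure Ω
  | 0 => boltzmann vol (S 0)
  | k + 1 => neStep (S k) (S (k + 1)) (κ k) (neMarginal vol S κ k)

/-- **E4 on general state spaces (Jarzynski / AIS / NE-MCMC exactness, Feynman–Kac form).**
If every kernel `κ j` (`j < k`) leaves its Boltzmann measure `e^{−S (j+1)} vol` invariant, the
`k`-th weighted marginal equals `e^{−S k} vol`: `E[e^{−W_k} f(X_k)] = ∫ f e^{−S k} dvol` for all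
`f` — in particular `E[e^{−W_k}] = Z_k` (start un-normalised; `= Z_k/Z_0` from the Gibbs start)
and the reweighted estimator targets `e^{−S k} vol / Z_k` exactly. -/
theorem neMarginal_eq_boltzmann {vol : Measure Ω} {S : ℕ → Ω → ℝ} (hS : ∀ k, Measurable (S k))
    {κ : ℕ → Kernel Ω Ω} :
    ∀ k, (∀ j < k, Kernel.Invariant (κ j) (boltzmann vol (S (j + 1)))) →
      neMarginal vol S κ k = boltzmann vol (S k)
  | 0, _ => rfl
  | k + 1, hκ => by
    show neStep (S k) (S (k + 1)) (κ k) (neMarginal vol S κ k) = boltzmann vol (S (k + 1))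
    rw [neMarginal_eq_boltzmann hS k fun j hj => hκ j (Nat.lt_succ_of_lt hj)]
    exact neStep_boltzmann (hS k) (hS (k + 1)) (hκ k (Nat.lt_succ_self k))

/-- The same as an identity of integrals: `∫ f dν_k = ∫ f e^{−S k} dvol` for measurable `f ≥ 0`. -/
theorem lintegral_neMarginal {vol : Measure Ω} {S : ℕ → Ω → ℝ} (hS : ∀ k, Measurable (S k))
    {κ : ℕ → Kernel Ω Ω} {k : ℕ}
    (hκ : ∀ j < k, Kernel.Invariant (κ j) (boltzmann vol (S (j + 1)))) {f : Ω → ℝ≥0∞}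
    (hf : Measurable f) :
    ∫⁻ x, f x ∂(neMarginal vol S κ k) = ∫⁻ x, ENNReal.ofReal (Real.exp (-S k x)) * f x ∂vol := by
  have hd : Measurable fun x => ENNReal.ofReal (Real.exp (-S k x)) :=
    (Real.measurable_exp.comp (hS k).neg).ennreal_ofReal
  rw [neMarginal_eq_boltzmann hS k hκ, boltzmann, lintegral_withDensity_eq_lintegral_mul _ hd hf]
  rfl

end Summit.Ventures.LatticeQCDFlow.Exactness
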